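import Summits.QuantumFields.BalabanUV.T4Continuum.Spine.NE1p.DressedRoot
import Summits.QuantumFields.BalabanUV.T4Continuum.Support.T4TrajectoryDensityPerWindow
import Summits.QuantumFields.BalabanUV.T4Continuum.Spine.NE1p.DressedWindowSchedule

/-!
# T⁴ programme, spine estimate NE1′ (node O3b/H2) — END-F WITH PER-STEP CHART WINDOWS (END-F-win) and the kernel form of the
# located window cost of a uniform radius floor (supplier «R-b», finding F-ne1pleaf08-1)

Cell `pub-balaban`, sub-cell `t4`, BINDER-OWNERS row NE1′, NE1′ formalisation swarm `b2b-balaban-t4-ne1p-formalise-*`, leaf prover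
08 (own-initiative SUPPLIER item «R-b», INTENT NE1p-Rb, HOME/CLAIMS.log l.8748 — leaf-04 «GO» l.8878; not a crew row); tree target
`Summits/QuantumFields/BalabanUV/T4Continuum/Spine/NE1p/`; ADDITIVE — imports the row root `Spine/NE1p/DressedRoot` (p211416),
`Support/T4TrajectoryDensityPerWindow` (the `_win` chain, this seat, p212994) and row S1's `Spine/NE1p/DressedWindowSchedule` (p212498,
for §0 only) ONLY; modifies nothing; END-F / END-F′ of the
owner (p211416) and of row S2 (p212485) are untouched and remain the faces of record unless the owner adopts these.

WHY (finding F-ne1pleaf08-1).  Composing row S1 (`DressedWindowSchedule`, p212498) with row S2 (`DressedTransportAssembled`, p212485)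
forces cutoff-dependent constants through TWO typed-interface features, neither of which is Bałaban's: (a) S2's UNIFORM chart-radius
floor `r_*` is consumed once per met step from the birth window (`K·r_* < ρw 0`, then `hcm : ‖c‖·r ≤ m·r_*` makes `m ≥ K·‖c‖r/ρw 0`)
— cured by the MODULI ROUTE of `Support/T4TrajectoryDensityAssemblyMod` (supplier «R-a′»: the fresh response paid by the
transported response modulus `(4/r)·stepProd α·gen`, no radius in any constant; its Spine face is `DressedTransportAssembledMod`);
(b) END-F's (N2) binder is asked for ALL chart motions
of bound `≤ w` although the chain uses it only at the pair's defect (`hpair_add … (hpδ.trans hδ)`), so every met step consumes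
`w` of window (`WindowSchedule.window_budget`: `ρw K + K·w ≤ ρw 0`) — cured by the per-step windows `wk b k′ k` of
`T4TrajectoryDensityPerWindow`.  This file records the cost in kernel (§0 `window_budget_floor`, `budgetFactor_lower_bound`: under ANY `WindowSchedule` a
uniform floor costs `K·(w + r_*)` of birth window and forces `K·‖c‖·r ≤ m·ρw 0` — the `m`-consequence of row S1b's own
`DressedTransportScheduled.floor_window_budget`, p212880) and is the Spine face of cure (b): §1 END-F-win.  With geometric `wk`,
`ϱ₁`, `σ` (the cell's birth-frame reading «a unit scale-k fluctuation read in the j-frame has N d = O(L^{−(k−j)})»,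
`T4BirthChartTransport.slice_bound`) a window schedule with FINITE, CUTOFF-FREE total consumption of the (N1)/(N2) nestings exists
(leaf-04's announced «S1-win»); whether Bałaban's windows
([Balaban1989LargeFieldI] p. 190, (1.27) p. 187 — TYPE/CONTEXT only) accommodate its constants is (w3)⁺'s located content
(OWNER-ANSWERS-g23 §F/§G), untouched here.

HONEST FRAMING.  Rung (B)+1 bookkeeping on ONE finite four-torus of fixed physical size — NOT infinite volume, NOT a mass gap, NOT
OS on ℝ⁴, NOT the Clay problem, NOT summit progress.  NE1′ is NOT PRINTED and NOT PROVED; this file reads «L-T ⇐ the displayed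
binders (per-step-window form)», never «NE1′ proved»; every wall binder of `t4/T4-EST-NE1p-P1.md` §4 stays DISPLAYED ((w1) `hsl`,
H2 `hFn`/`h𝒢`, (w2-act) `hB`/`hE` — printed TYPE [Balaban1989LargeFieldII] (1.65) p. 375, (1.71)–(1.75) pp. 379–380, asserted for
Bałaban's densities NOWHERE —, `hP`, (w3)⁺ nesting, (w4) `hdom`, (I4′) `hrate`, attainment, invariance); 0 binders instantiated on
Bałaban's densities; no `def … : Prop`; [folklore] kernel glue, 0 sorry, 0 citations used as hypothesis-free facts.  Spine PROVED
0∕9 unchanged.  HONEST DEPENDENCY: continuum YM on T⁴ ⇐ BetaPertH ∧ nine spine estimates (0/9 proved); BetaPertH ⇐ (D1) ∧ (D4) ∧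
CAP+tail; G-an2-4 gates asym, D1 and NE2/3/4.
-/

noncomputable section

namespace Summit.QuantumFields.BalabanUV.T4Continuum.NE1p.DressedRootWin

open MeasureTheory Set Metric Filter Finset
open scoped BigOperators
open Literature.MathematicalPhysics.QuantumFieldTheory.Balaban1983to89
open Literature.MathematicalPhysics.QuantumFieldTheory.Balaban1983to89.T4TermFormat
open Literature.MathematicalPhysics.QuantumFieldTheory.Balaban1983to89.T4TermFormat.Booking
open Literature.MathematicalPhysics.QuantumFieldTheory.Balaban1983to89.T4GatedBooking
open Literature.MathematicalPhysics.QuantumFieldTheory.Balaban1983to89.T4TrajectoryComparison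
open Literature.MathematicalPhysics.QuantumFieldTheory.Balaban1983to89.T4TrajectoryModulus
open Summit.QuantumFields.BalabanUV.T4Continuum.T4TrajectoryDensityDressed
open Summit.QuantumFields.BalabanUV.T4Continuum.NE1p.DressedRoot
open T4BirthChartTransport (GaugeInvariant BirthSlice RelGauge)
open T4BlockTransport (Fld NDir latMove latN latMove_zero)
open T4TrajectoryDensity

/-! ## §0 The located cost, kernel form: a uniform radius floor under a window schedule [arith] -/

section Cost

open Summit.QuantumFields.BalabanUV.T4Continuum.NE1p.DressedWindowSchedule

variable {r w : ℝ} (W : WindowSchedule r w)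

/-- **A UNIFORM FLOOR IS CONSUMED ONCE PER MET STEP** (finding F-ne1pleaf08-1 (1)–(3)) [arith]: if the chart radii of a window
schedule stay above a uniform floor `r_*` for the first `K` steps (row S2's `hϱfloor` composed with row S1's `ϱ f k″ k := ϱc k`),
then the birth window exceeds the final one by at least `K·(w + r_*)`: the gap `ρw (k+1) + w + ϱ₁ k + σ k ≤ ρw k` with
`r_* ≤ ϱc k < ϱ₁ k` and `0 < σ k`.  (`WindowSchedule.window_budget` is the case `r_* = 0`.) [folklore] -/
theorem window_budget_floor {rstar : ℝ} :
    ∀ K : ℕ, (∀ k, k < K → rstar ≤ W.ϱc k) → W.ρw K + K * (w + rstar) ≤ W.ρw 0 := by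
  intro K
  induction K with
  | zero => intro _; simp
  | succ K ih =>
    intro hfloor
    have h1 := ih fun k hk => hfloor k (Nat.lt_succ_of_lt hk)
    have h2 := W.hgap K
    have h3 := hfloor K (Nat.lt_succ_self K)
    have h4 := W.hϱc₁ K
    have h5 := W.hσ K
    push_cast
    linarith

/-- **HENCE THE BUDGET FACTOR GROWS WITH THE CUTOFF** [arith]: with a nonnegative final window, row S2's source-vs-budget condition
`‖c‖·r ≤ m·r_*` (`m ≥ 0`) under such a schedule forces `K·(‖c‖·r) ≤ m·ρw 0` — for cutoff-free `‖c‖`, `r`, `ρw 0` the factor `m`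
of `UniformConstants` is at least linear in the number of met steps (trigger caveat k1).  Cure: the moduli route
(`Support/T4TrajectoryDensityAssemblyMod`, `Spine/NE1p/DressedTransportAssembledMod`: `‖c‖ ≤ m`, no floor). [folklore] -/
theorem budgetFactor_lower_bound {rstar cnorm m : ℝ} {K : ℕ} (hfloor : ∀ k, k < K → rstar ≤ W.ϱc k)
    (hρK : 0 ≤ W.ρw K) (hm : 0 ≤ m) (hcm : cnorm * r ≤ m * rstar) :
    (K : ℝ) * (cnorm * r) ≤ m * W.ρw 0 := by
  have hK : (0 : ℝ) ≤ K := Nat.cast_nonneg K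
  have hb := window_budget_floor W K hfloor
  have hw : 0 < w := W.w_pos
  have h1 : (K : ℝ) * rstar ≤ W.ρw 0 := by nlinarith
  calc (K : ℝ) * (cnorm * r) ≤ K * (m * rstar) := mul_le_mul_of_nonneg_left hcm hK
    _ = m * (K * rstar) := by ring
    _ ≤ m * W.ρw 0 := mul_le_mul_of_nonneg_left h1 hm

end Cost

/-! ## §1 END-F-win: the transport leaf under the dressed gate, per-step chart windows [bookkeeping] -/

section ENDFwin

variable {B : T4TermFormat.Booking} {T : Trajectory B}
variable {R : Type*} [NormedRing R] [NormedAlgebra ℂ R] [MeasurableSpace R] {d : ℕ}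
  {F : Type*} [NormedAddCommGroup F] [NormedSpace ℂ F] [CompleteSpace F]

/-- **END-F-win — THE TRANSPORT LEAF `htr`, GATED BY THE DRESSED BUDGET, WITH PER-STEP CHART WINDOWS** [bookkeeping]:
`DressedRoot.transportLeaf_of_centredExponent` (END-F, p211416) VERBATIM except: the nesting binder (N2) `hN2` is asked only for
chart motions of declared bound `≤ wk b k′ (k+1)` — a per-generation, per-step window `wk b k′ k` with `hwk : wk ≤ w`,
`hwk_anti : wk b k′ (k+1) ≤ wk b k′ k`, `hθwk : θ b k ≤ wk b k′ k` and `hdefwk : defect b k′ k ≤ wk b k′ k` (replacing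
`hdefw : defect ≤ w`).  Proof: `T4TrajectoryDensityPerWindow.transportsFromVar_of_centredExponent_lattice_fam_gated_win` with
`Gate := budgetGate …`, `s₁ b k := m·Σ_{f∈S k b} envVar …`, its `hs` discharged by `hs_of_budgetGate`.  Conclusion: EXACTLY the
field `htr` of `BookingLeaves` with `C = 4c_δ/r`, `ρ i = ψ·α i`.  The window consumed by (N2) along a family's life is now
`Σ_k (wk b k′ k + diam D b k)` instead of `K·w` (finding F-ne1pleaf08-1 (4)); every wall binder stays displayed; nothing of
Bałaban's densities is asserted. [folklore] -/
theorem transportLeaf_of_centredExponent_win {Fn : B.Birth → ℕ → ℕ → Fld d R → F}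
    {rel : B.Birth → ℕ → ℕ → Fld d R → Fld d R → Prop} {𝒦 : B.Birth → ℕ → ℕ → Set (Fld d R)}
    {ref : B.Birth → ℕ → Fld d R → Fld d R} {base : B.Birth → ℕ → Fld d R → ℝ}
    {𝒜 𝒬 : B.Birth → ℕ → Fld d R → Fld d R → ℂ} {q : B.Birth → ℕ → Fld d R → ℂ}
    {μ : B.Birth → ℕ → Measure (Fld d R)} {z₀ : B.Birth → ℕ → Fld d R} {D : B.Birth → ℕ → Set (Fld d R)}
    {defect wk : B.Birth → ℕ → ℕ → ℝ} {cδ ψ w r m : ℝ} {s θ : B.Birth → ℕ → ℝ} {α : ℕ → ℝ}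
    {ϱ : B.Birth → ℕ → ℕ → ℝ} {S : ℕ → B.Birth → Finset B.Birth}
    (hα : ∀ i, 0 ≤ α i) (hr : 0 < r) (hw : 0 < w)
    (hsl : ∀ (b : B.Birth) (k' : ℕ), B.birthScale b ≤ k' → k' ≤ B.K →
      RanBelow (budgetGate T s m S (4 * cδ / r) (fun i => ψ * α i)) k' →
      BirthSlice (Fn b k' k') latMove latN (𝒦 b k' k') w r (T.gen b k'))
    (hFn : ∀ (b : B.Birth) (k' k : ℕ), B.birthScale b ≤ k' → k' ≤ k → k + 1 ≤ B.K →
      RanBelow (budgetGate T s m S (4 * cδ / r) (fun i => ψ * α i)) (k + 1) →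
      ∀ U, Fn b k' (k + 1) U =
        wOp (expWeight (base b k) (𝒜 b k + 𝒬 b k)) (μ b k) (z₀ b k) U (fun z => Fn b k' k (U + z)))
    (h𝒢 : ∀ (b : B.Birth) (k' k : ℕ), B.birthScale b ≤ k' → k' ≤ k → k + 1 ≤ B.K →
      RanBelow (budgetGate T s m S (4 * cδ / r) (fun i => ψ * α i)) (k + 1) →
      ∀ U, (fun z => Fn b k' k (U + z)) ∈ BddClass F (μ b k))
    (hD : ∀ b k, (D b k).Nonempty) (hϱ : ∀ b k' k, 0 < ϱ b k' k)
    (hB : ∀ (b : B.Birth) (k' k : ℕ), B.birthScale b ≤ k' → k' ≤ k → k + 1 ≤ B.K →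
      RanBelow (budgetGate T s m S (4 * cδ / r) (fun i => ψ * α i)) (k + 1) →
      RealBaseAt (ref b k) (base b k) (𝒜 b k) (μ b k) (𝒦 b k' (k + 1)))
    (hE : ∀ (b : B.Birth) (k' k : ℕ), B.birthScale b ≤ k' → k' ≤ k → k + 1 ≤ B.K →
      RanBelow (budgetGate T s m S (4 * cδ / r) (fun i => ψ * α i)) (k + 1) →
      ExponentSliceAt (ref b k) (𝒜 b k) (μ b k) latMove latN (𝒦 b k' (k + 1)) w (ϱ b k' k) (s b k))
    (hP : ∀ (b : B.Birth) (k' k : ℕ), B.birthScale b ≤ k' → k' ≤ k → k + 1 ≤ B.K →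
      RanBelow (budgetGate T s m S (4 * cδ / r) (fun i => ψ * α i)) (k + 1) →
      PertSlice (fun U z => 𝒬 b k U z - q b k U) (μ b k) latMove latN (𝒦 b k' (k + 1)) w (ϱ b k' k)
        (m * ∑ f ∈ S k b, T.envVar (4 * cδ / r) (fun i => ψ * α i) f k))
    (hDμ : ∀ b k, ∀ᵐ z ∂μ b k, z ∈ D b k)
    (hN1 : ∀ (b : B.Birth) (k' k : ℕ), B.birthScale b ≤ k' → k' ≤ k → k + 1 ≤ B.K →
      ∀ z ∈ D b k, ∀ U ∈ 𝒦 b k' (k + 1), U + z ∈ 𝒦 b k' k)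
    -- (N2) RE-CUT: chart motions of declared bound ≤ the NEXT step's window only
    (hN2 : ∀ (b : B.Birth) (k' k : ℕ), B.birthScale b ≤ k' → k' ≤ k → k + 1 ≤ B.K →
      ∀ U₀ ∈ 𝒦 b k' (k + 1), ∀ p : NDir d R, latN p ≤ wk b k' (k + 1) → ∀ z' ∈ D b k,
        latMove U₀ p 1 + z' ∈ 𝒦 b k' k)
    (hdiam : ∀ b k, ∀ z ∈ D b k, ∀ z' ∈ D b k, ∀ x ν, ‖z x ν - z' x ν‖ ≤ θ b k)
    (hθ : ∀ b k, 0 < θ b k ∧ θ b k ≤ w) (hθwk : ∀ b k' k, θ b k ≤ wk b k' k)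
    (hwk : ∀ b k' k, wk b k' k ≤ w) (hwk_anti : ∀ b k' k, wk b k' (k + 1) ≤ wk b k' k)
    (hdom : ∀ (b : B.Birth) (k' k : ℕ), B.birthScale b ≤ k' → k' ≤ k → k + 1 ≤ B.K →
      Real.exp 3 * (1 + 4 * θ b k / ϱ b k' k) ≤ α k)
    (hinv : ∀ b k' k, GaugeInvariant (rel b k' k) (Fn b k' k))
    (hdefwk : ∀ b k' k, defect b k' k ≤ wk b k' k)
    (hrate : ∀ (b : B.Birth) (k' k : ℕ), B.birthScale b ≤ k' → k' ≤ k → k ≤ B.K →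
      defect b k' k ≤ cδ * ψ ^ (k - k'))
    (hlin : ∀ (b : B.Birth) (k' k : ℕ), B.birthScale b ≤ k' → k' ≤ k → k ≤ B.K →
      RanBelow (budgetGate T s m S (4 * cδ / r) (fun i => ψ * α i)) k → ∀ ε > 0,
      ∃ U₀ ∈ 𝒦 b k' k, ∃ U₁ : Fld d R, RelGauge (rel b k' k) latMove latN U₀ U₁ (defect b k' k) ∧
        T.lin b k' k ≤ ‖Fn b k' k U₁ - Fn b k' k U₀‖ + ε) :
    T.TransportsFromVar (4 * cδ / r) (fun i => ψ * α i) (budgetGate T s m S (4 * cδ / r) (fun i => ψ * α i)) :=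
  transportsFromVar_of_centredExponent_lattice_fam_gated_win
    (Gate := budgetGate T s m S (4 * cδ / r) (fun i => ψ * α i))
    (s₁ := fun b k => m * ∑ f ∈ S k b, T.envVar (4 * cδ / r) (fun i => ψ * α i) f k)
    hα hr hw hsl hFn h𝒢 hD hϱ hB hE hP (hs_of_budgetGate (T := T)) hDμ hN1 hN2 hdiam hθ hθwk hwk hwk_anti hdom hinv
    hdefwk hrate hlin

end ENDFwin


end Summit.QuantumFields.BalabanUV.T4Continuum.NE1p.DressedRootWin

end
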